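import Summits.CriticalPhenomena.CardyFormulaZ2.Theorems.CardyIKTransportIKLinearTransportTwoCutDefs

/-!
# Stub `stub_RectIdentity` — the abstract rectangle identity on the product Bernoulli space `SDE.PJ`

Support file (`--supports stmt-CriticalPhenomena-5076`, registered stub `stub_RectIdentity`, line
pinned-diagram-exchange).

On a measurable set `E ⊆ SDE.KJ` which is stable under importing the coordinates in `A` from another of its points
(`SDE.glue A g g' ∈ E` for `g, g' ∈ E`), a measurable `Y` reading only the `A`-coordinates on `E` and a measurable `R`
reading only the other coordinates on `E` are independent given `E`:
`P(E ∩ R⁻¹B ∩ Y⁻¹y) · P(E) = P(E ∩ Y⁻¹y) · P(E ∩ R⁻¹B)` (`TcRectIdentity`, §5 of `…TwoCutDefs.lean`).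

PROOF. If `E = ∅` all four measures vanish. Otherwise fix `g₀ ∈ E`. Stability gives the RECTANGLE CHARACTERISATION
`SDE.glue A g₁ g₂ ∈ E ↔ SDE.glue A g₁ g₀ ∈ E ∧ SDE.glue A g₀ g₂ ∈ E`, so that under the gluing map
`G (g₁, g₂) = SDE.glue A g₁ g₂` the set `E ∩ R⁻¹B ∩ Y⁻¹T` pulls back to the rectangle
`(C ∩ {R (glue A · g₀) ∈ B}) ×ˢ (F ∩ {Y (glue A g₀ ·) ∈ T})` with `C = {g | glue A g g₀ ∈ E}`,
`F = {g | glue A g₀ g ∈ E}` (the dependence hypotheses transport `R`, `Y` along the sections). By the gluing lemma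
`SDE.infinitePi_glue` (`PJ = (PJ ⊗ PJ).map G`) and `Measure.prod_prod`, `P(E ∩ R⁻¹B ∩ Y⁻¹T)` is the product of the
two marginal masses; the four instances `(B, {y})`, `(univ, univ)`, `(univ, {y})`, `(B, univ)` turn the identity into a
commutative-ring identity.
-/

noncomputable section

namespace Summit.CriticalPhenomena.CardyFormulaZ2.Theorems.IKLinearTransport.PinnedDiagramExchange

open scoped Classical MeasureTheory ENNReal symmDiff
open Set MeasureTheory
open Literature.Probability.Percolation Literature.Probability.LatticeModels

/-! ## §1 Pointwise algebra of the gluing -/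

/-- Off `A` the gluing reads the first sample. [folklore] -/
theorem rid_glue_apply_of_not_mem {A : Set SDE.JIdx} {j : SDE.JIdx} (hj : j ∉ A) (g₁ g₂ : SDE.KJ) :
    SDE.glue A g₁ g₂ j = g₁ j := if_neg hj

/-- On `A` the gluing reads the second sample. [folklore] -/
theorem rid_glue_apply_of_mem {A : Set SDE.JIdx} {j : SDE.JIdx} (hj : j ∈ A) (g₁ g₂ : SDE.KJ) :
    SDE.glue A g₁ g₂ j = g₂ j := if_pos hj

/-- Re-gluing on the right forgets the old `A`-part. [folklore] -/
theorem rid_glue_glue_left (A : Set SDE.JIdx) (g₁ g₂ g₃ : SDE.KJ) :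
    SDE.glue A (SDE.glue A g₁ g₂) g₃ = SDE.glue A g₁ g₃ := by
  funext j
  by_cases hj : j ∈ A
  · simp [SDE.glue, hj]
  · simp [SDE.glue, hj]

/-- Re-gluing on the left forgets the old off-`A`-part. [folklore] -/
theorem rid_glue_glue_right (A : Set SDE.JIdx) (g₁ g₂ g₃ : SDE.KJ) :
    SDE.glue A g₁ (SDE.glue A g₂ g₃) = SDE.glue A g₁ g₃ := by
  funext j
  by_cases hj : j ∈ A
  · simp [SDE.glue, hj]
  · simp [SDE.glue, hj]

/-! ## §2 The rectangle characterisation of a glue-stable set -/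

/-- RECTANGLE CHARACTERISATION: for a set `E` stable under `SDE.glue A` and a base point `g₀ ∈ E`, a glued point
`SDE.glue A g₁ g₂` lies in `E` iff its off-`A` section through `g₀` and its `A`-section through `g₀` do. [folklore] -/
theorem rid_glue_mem_iff {A : Set SDE.JIdx} {E : Set SDE.KJ}
    (hstab : ∀ g g' : SDE.KJ, g ∈ E → g' ∈ E → SDE.glue A g g' ∈ E) {g₀ : SDE.KJ} (hg₀ : g₀ ∈ E) (g₁ g₂ : SDE.KJ) :
    SDE.glue A g₁ g₂ ∈ E ↔ SDE.glue A g₁ g₀ ∈ E ∧ SDE.glue A g₀ g₂ ∈ E := by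
  constructor
  · intro h
    constructor
    · have h' := hstab _ _ h hg₀
      rwa [rid_glue_glue_left] at h'
    · have h' := hstab _ _ hg₀ h
      rwa [rid_glue_glue_right] at h'
  · rintro ⟨h1, h2⟩
    have h' := hstab _ _ h1 h2
    rwa [rid_glue_glue_left, rid_glue_glue_right] at h'

/-- On `E`, a function of the off-`A` coordinates reads a glued point through its off-`A` section. [folklore] -/
theorem rid_R_glue {A : Set SDE.JIdx} {E : Set SDE.KJ} {β : Type*} {R : SDE.KJ → β}
    (hstab : ∀ g g' : SDE.KJ, g ∈ E → g' ∈ E → SDE.glue A g g' ∈ E) {g₀ : SDE.KJ} (hg₀ : g₀ ∈ E)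
    (hRdep : ∀ g g' : SDE.KJ, g ∈ E → g' ∈ E → (∀ j ∉ A, g j = g' j) → R g = R g') {g₁ g₂ : SDE.KJ}
    (h : SDE.glue A g₁ g₂ ∈ E) : R (SDE.glue A g₁ g₂) = R (SDE.glue A g₁ g₀) :=
  hRdep _ _ h ((rid_glue_mem_iff hstab hg₀ g₁ g₂).1 h).1 fun j hj => by
    rw [rid_glue_apply_of_not_mem hj, rid_glue_apply_of_not_mem hj]

/-- On `E`, a function of the `A`-coordinates reads a glued point through its `A`-section. [folklore] -/
theorem rid_Y_glue {A : Set SDE.JIdx} {E : Set SDE.KJ} {β : Type*} {Y : SDE.KJ → β}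
    (hstab : ∀ g g' : SDE.KJ, g ∈ E → g' ∈ E → SDE.glue A g g' ∈ E) {g₀ : SDE.KJ} (hg₀ : g₀ ∈ E)
    (hYdep : ∀ g g' : SDE.KJ, g ∈ E → g' ∈ E → (∀ j ∈ A, g j = g' j) → Y g = Y g') {g₁ g₂ : SDE.KJ}
    (h : SDE.glue A g₁ g₂ ∈ E) : Y (SDE.glue A g₁ g₂) = Y (SDE.glue A g₀ g₂) :=
  hYdep _ _ h ((rid_glue_mem_iff hstab hg₀ g₁ g₂).1 h).2 fun j hj => by
    rw [rid_glue_apply_of_mem hj, rid_glue_apply_of_mem hj]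

/-- THE PULL-BACK OF `E ∩ R⁻¹B ∩ Y⁻¹T` UNDER THE GLUING IS A RECTANGLE. [folklore] -/
theorem rid_preimage_glue {A : Set SDE.JIdx} {E : Set SDE.KJ} {β γ : Type*} {Y : SDE.KJ → γ} {R : SDE.KJ → β}
    (hstab : ∀ g g' : SDE.KJ, g ∈ E → g' ∈ E → SDE.glue A g g' ∈ E) {g₀ : SDE.KJ} (hg₀ : g₀ ∈ E)
    (hYdep : ∀ g g' : SDE.KJ, g ∈ E → g' ∈ E → (∀ j ∈ A, g j = g' j) → Y g = Y g')
    (hRdep : ∀ g g' : SDE.KJ, g ∈ E → g' ∈ E → (∀ j ∉ A, g j = g' j) → R g = R g') (B : Set β) (T : Set γ) :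
    (fun p : SDE.KJ × SDE.KJ => SDE.glue A p.1 p.2) ⁻¹' (E ∩ R ⁻¹' B ∩ Y ⁻¹' T) =
      ({g | SDE.glue A g g₀ ∈ E} ∩ {g | R (SDE.glue A g g₀) ∈ B}) ×ˢ
        ({g | SDE.glue A g₀ g ∈ E} ∩ {g | Y (SDE.glue A g₀ g) ∈ T}) := by
  ext ⟨g₁, g₂⟩
  simp only [mem_preimage, mem_inter_iff, mem_prod, mem_setOf_eq]
  constructor
  · rintro ⟨⟨hE, hB⟩, hT⟩
    obtain ⟨h1, h2⟩ := (rid_glue_mem_iff hstab hg₀ g₁ g₂).1 hE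
    refine ⟨⟨h1, ?_⟩, h2, ?_⟩
    · rwa [rid_R_glue hstab hg₀ hRdep hE] at hB
    · rwa [rid_Y_glue hstab hg₀ hYdep hE] at hT
  · rintro ⟨⟨h1, hB⟩, h2, hT⟩
    have hE : SDE.glue A g₁ g₂ ∈ E := (rid_glue_mem_iff hstab hg₀ g₁ g₂).2 ⟨h1, h2⟩
    refine ⟨⟨hE, ?_⟩, ?_⟩
    · rwa [rid_R_glue hstab hg₀ hRdep hE]
    · rwa [rid_Y_glue hstab hg₀ hYdep hE]

/-! ## §3 The product formula and the identity -/

/-- `SDE.PJ` is the image of `SDE.PJ ⊗ SDE.PJ` under the gluing along `A` (the gluing lemma). [folklore] -/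
theorem rid_PJ_eq_map_glue (A : Set SDE.JIdx) :
    (SDE.PJ.prod SDE.PJ).map (fun p : SDE.KJ × SDE.KJ => SDE.glue A p.1 p.2) = SDE.PJ := by
  unfold SDE.PJ; exact SDE.infinitePi_glue _ _

/-- PRODUCT FORMULA: on a glue-stable measurable `E` with base point `g₀`, the mass of `E ∩ R⁻¹B ∩ Y⁻¹T` is the
product of the masses of the two sections of the rectangle. [folklore] -/
theorem rid_measure_eq_mul {A : Set SDE.JIdx} {E : Set SDE.KJ} {β γ : Type*} [MeasurableSpace β] [MeasurableSpace γ]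
    {Y : SDE.KJ → γ} {R : SDE.KJ → β} (hE : MeasurableSet E)
    (hstab : ∀ g g' : SDE.KJ, g ∈ E → g' ∈ E → SDE.glue A g g' ∈ E) {g₀ : SDE.KJ} (hg₀ : g₀ ∈ E)
    (hY : Measurable Y) (hR : Measurable R)
    (hYdep : ∀ g g' : SDE.KJ, g ∈ E → g' ∈ E → (∀ j ∈ A, g j = g' j) → Y g = Y g')
    (hRdep : ∀ g g' : SDE.KJ, g ∈ E → g' ∈ E → (∀ j ∉ A, g j = g' j) → R g = R g') {B : Set β}
    (hB : MeasurableSet B) {T : Set γ} (hT : MeasurableSet T) :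
    SDE.PJ (E ∩ R ⁻¹' B ∩ Y ⁻¹' T) =
      SDE.PJ ({g | SDE.glue A g g₀ ∈ E} ∩ {g | R (SDE.glue A g g₀) ∈ B}) *
        SDE.PJ ({g | SDE.glue A g₀ g ∈ E} ∩ {g | Y (SDE.glue A g₀ g) ∈ T}) := by
  have hS : MeasurableSet (E ∩ R ⁻¹' B ∩ Y ⁻¹' T) := (hE.inter (hR hB)).inter (hY hT)
  have h1 : SDE.PJ (E ∩ R ⁻¹' B ∩ Y ⁻¹' T) =
      (SDE.PJ.prod SDE.PJ).map (fun p : SDE.KJ × SDE.KJ => SDE.glue A p.1 p.2) (E ∩ R ⁻¹' B ∩ Y ⁻¹' T) := by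
    rw [rid_PJ_eq_map_glue]
  rw [h1, Measure.map_apply (cmk_measurable_glue A) hS, rid_preimage_glue hstab hg₀ hYdep hRdep B T,
    Measure.prod_prod]

/-- Registered stub `stub_RectIdentity`: THE ABSTRACT RECTANGLE IDENTITY `TcRectIdentity A` for every coordinate set
`A` — on a glue-stable measurable set of the product Bernoulli space, a function of the `A`-coordinates and a function of
the other coordinates are independent. [folklore] -/
theorem stub_RectIdentity : ∀ A : Set SDE.JIdx, TcRectIdentity A := by
  intro A E hE hstab Y R hY hR hYdep hRdep B hB y
  rcases E.eq_empty_or_nonempty with rfl | ⟨g₀, hg₀⟩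
  · simp
  · have h1 := rid_measure_eq_mul hE hstab hg₀ hY hR hYdep hRdep hB (measurableSet_singleton y)
    have h2 := rid_measure_eq_mul hE hstab hg₀ hY hR hYdep hRdep MeasurableSet.univ
      (MeasurableSet.univ : MeasurableSet (univ : Set (Bool × Bool × Bool)))
    have h3 := rid_measure_eq_mul hE hstab hg₀ hY hR hYdep hRdep MeasurableSet.univ (measurableSet_singleton y)
    have h4 := rid_measure_eq_mul hE hstab hg₀ hY hR hYdep hRdep hB
      (MeasurableSet.univ : MeasurableSet (univ : Set (Bool × Bool × Bool)))
    simp only [preimage_univ, inter_univ, mem_univ, setOf_true] at h2 h3 h4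
    rw [h1, h3, h4, h2]
    ring

end Summit.CriticalPhenomena.CardyFormulaZ2.Theorems.IKLinearTransport.PinnedDiagramExchange
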